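import Summits.QuantumAdvantage.QuantumAdvantage.Theorems.LightDialA

/-! # LightDialC1 — part C1 — parity classes, the witness as a degree-2 cube function, the SAME-PARITY law

NODE «LightDial» (decomp-qadv lens-2 g26) — the PREDECESSOR WITNESS `predW_b(x) = E_b + 2·E_b·O_b + 2·x_{b+1} (mod 3)` (`E_b/O_b` = number
of ones at the positions of the same / the other parity as `b`, even ring): an explicit rotation-covariant QUADRATIC strategy that is perfect on
every odd-class input of Hamming weight `≤ 5` at every even length — so `¬ LightFail 2 3` and `¬ LightFail 2 5` are THEOREMS (parts C3, C5) and the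
law-bet piece `LightFail 2 w → NoPerfectTwo3` of the dial (Theorems.LightDialA/B) is to be read at `w ≥ 7` (numerically the threshold is exactly 7:
g26 `num/Q-STRUCTURE.md`, critic 69v66). Five files C1 → … → C5 (gate form ≤ 400 lines each); rung 0, nothing here bears on 27432 itself.

THIS FILE: §8 parity classes of the even ring; §9 `predW`, `predAns`, `predW_mem_lowDeg : predW i ∈ lowDeg (ZMod 3) n 2`; §10 ★ `rel_predW_of_sameParity`:
on an odd-class input whose ones all have one parity the kernel vector is the OTHER parity class (`inKernel_parClass`), sign bit `0`, and the
witness answers `≠ 1` there (splits `(1,0)`, `(3,0)`, `(5,0)`, …); §11 `PredWPerfect n w` and the reductions to `n ∉ lightLosing 2 w` / `¬ LightFail 2 w`.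
-/

set_option linter.dupNamespace false
set_option linter.unnecessarySeqFocus false
noncomputable section
open scoped Classical

namespace Summit.QuantumAdvantage.QuantumAdvantage.Theorems.LightDial
open Finset
open Literature.Computability.QuantumComplexity Literature.Computability.QuantumComplexity.RingHLF
open Literature.Computability.MetaComplexity Literature.Computability.MetaComplexity.Smolensky
open Summit.QuantumAdvantage.AdviceFreeQNC0
open Summit.QuantumAdvantage.QuantumAdvantage.Theorems.RingPeriodFold (kvec kernel_pair_of_oddZeros kvec_ne_zero rel_iff_of_kernel_pair)

variable {n : ℕ}

/-! ## §8 Parity classes of the even ring -/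

/-- the (nat-)parity of a ring position; for even `n` the two values are the two cosets of `2ℤ/nℤ`. -/
def par (i : Fin n) : ℕ := i.val % 2

/-- the position parity is `0` or `1`. -/
theorem par_lt_two (i : Fin n) : par i < 2 := Nat.mod_lt _ (by norm_num)

/-- on an even ring the successor has the other parity. -/
theorem par_nxt (hn : Even n) (b : Fin n) : par (nxt b) = (par b + 1) % 2 := by
  obtain ⟨m, hm⟩ := hn
  have hb := b.isLt
  show (b.val + 1) % n % 2 = (b.val % 2 + 1) % 2
  by_cases h : b.val + 1 < n
  · rw [Nat.mod_eq_of_lt h]; omega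
  · have he : b.val + 1 = n := by omega
    rw [he, Nat.mod_self]; omega

/-- on an even ring the predecessor has the other parity. -/
theorem par_prv (hn : Even n) (b : Fin n) : par (prv b) = (par b + 1) % 2 := by
  obtain ⟨m, hm⟩ := hn
  have hb := b.isLt
  show (b.val + n - 1) % n % 2 = (b.val % 2 + 1) % 2
  by_cases h : b.val = 0
  · rw [h, Nat.zero_add, Nat.mod_eq_of_lt (show n - 1 < n by omega)]; omega
  · have he : b.val + n - 1 = (b.val - 1) + n := by omega
    rw [he, Nat.add_mod_right, Nat.mod_eq_of_lt (show b.val - 1 < n by omega)]; omega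

/-- predecessor and successor have the same parity (even ring). -/
theorem par_prv_eq_par_nxt (hn : Even n) (b : Fin n) : par (prv b) = par (nxt b) := by
  rw [par_prv hn, par_nxt hn]

/-- the successor never has the same parity (even ring). -/
theorem par_nxt_ne (hn : Even n) (b : Fin n) : par (nxt b) ≠ par b := by
  rw [par_nxt hn]; have := par_lt_two b; unfold par at *; omega

/-- the indicator vector of the parity class `q`. -/
def parClass (q : ℕ) : Fin n → Bool := fun j => decide (par j = q)

/-- membership in a parity class, as a Boolean. -/
theorem parClass_apply (q : ℕ) (j : Fin n) : parClass q j = decide (par j = q) := rfl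

/-! ## §9 The predecessor witness `predW` and its degree -/

/-- number of ones of `x` on the parity class of `i`. -/
def ecnt (i : Fin n) (x : Fin n → Bool) : ℕ := (univ.filter fun j : Fin n => x j = true ∧ par j = par i).card

/-- number of ones of `x` off the parity class of `i`. -/
def ocnt (i : Fin n) (x : Fin n → Bool) : ℕ := (univ.filter fun j : Fin n => x j = true ∧ par j ≠ par i).card

/-- ★ THE PREDECESSOR WITNESS: output `i` of the rule `E_i + 2·E_i·O_i + 2·x_{i+1}` over `𝔽₃` (answer bit = `[value = 1]`).
On light inputs it is the «predecessor rule»: weight 1 ↦ the parity class of the marked point; weight 3, 5 ↦ the predecessors of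
the majority-parity ones if the parity split is balanced (`(2,1)`, `(3,2)`), else nothing (g26 `num/Q-STRUCTURE.md`). -/
def predW (i : Fin n) : CubeFn (ZMod 3) n := fun x =>
  (ecnt i x : ZMod 3) + 2 * (ecnt i x : ZMod 3) * (ocnt i x : ZMod 3) + 2 * (if x (nxt i) = true then 1 else 0)

/-- the answer string of the witness. -/
def predAns (x : Fin n → Bool) : Fin n → Bool := fun i => decide (predW i x = 1)

/-- the linear form «number of ones on the parity class of `i`» as a cube function. -/
def ecntFn (i : Fin n) : CubeFn (ZMod 3) n := fun x => (ecnt i x : ZMod 3)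

/-- the linear form «number of ones off the parity class of `i`». -/
def ocntFn (i : Fin n) : CubeFn (ZMod 3) n := fun x => (ocnt i x : ZMod 3)

/-- a degree-one monomial is a coordinate indicator. -/
theorem mono_singleton_apply {F : Type*} [Field F] (j : Fin n) (x : Fin n → Bool) :
    mono F ({j} : Finset (Fin n)) x = if x j = true then 1 else 0 := by
  rw [mono_apply]; simp

/-- a class count is a sum of coordinates: degree `≤ 1`. -/
theorem ecntFn_eq_sum (i : Fin n) :
    ecntFn i = ∑ j ∈ univ.filter (fun j : Fin n => par j = par i), mono (ZMod 3) ({j} : Finset (Fin n)) := by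
  funext x
  rw [Finset.sum_apply]
  simp only [ecntFn, ecnt, mono_singleton_apply]
  rw [← Finset.natCast_card_filter, Finset.filter_filter]
  congr 2; ext j; simp [and_comm]

/-- the other-parity count as a sum of coordinate monomials. -/
theorem ocntFn_eq_sum (i : Fin n) :
    ocntFn i = ∑ j ∈ univ.filter (fun j : Fin n => par j ≠ par i), mono (ZMod 3) ({j} : Finset (Fin n)) := by
  funext x
  rw [Finset.sum_apply]
  simp only [ocntFn, ocnt, mono_singleton_apply]
  rw [← Finset.natCast_card_filter, Finset.filter_filter]
  congr 2; ext j; simp [and_comm]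

/-- the same-parity count is a linear cube function. -/
theorem ecntFn_mem (i : Fin n) : ecntFn i ∈ lowDeg (ZMod 3) n 1 := by
  rw [ecntFn_eq_sum]
  exact Submodule.sum_mem _ fun j _ => mono_mem_lowDeg (by simp)

/-- the other-parity count is a linear cube function. -/
theorem ocntFn_mem (i : Fin n) : ocntFn i ∈ lowDeg (ZMod 3) n 1 := by
  rw [ocntFn_eq_sum]
  exact Submodule.sum_mem _ fun j _ => mono_mem_lowDeg (by simp)

/-- reassociation over `𝔽₃` with opaque atoms (keeps `ring` away from the `Finset.card` atoms). -/
theorem predW_eq_aux (E O t : ZMod 3) : E + 2 * E * O + 2 * t = E + 2 * (E * O) + 2 * t := by ring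

/-- the witness as an element of the algebra: linear + 2·(linear·linear) + 2·coordinate. -/
theorem predW_eq (i : Fin n) :
    predW i = ecntFn i + (2 : ZMod 3) • (ecntFn i * ocntFn i) + (2 : ZMod 3) • mono (ZMod 3) ({nxt i} : Finset (Fin n)) := by
  funext x
  show (ecnt i x : ZMod 3) + 2 * (ecnt i x : ZMod 3) * (ocnt i x : ZMod 3) + 2 * (if x (nxt i) = true then 1 else 0)
      = (ecnt i x : ZMod 3) + 2 * ((ecnt i x : ZMod 3) * (ocnt i x : ZMod 3)) + 2 * mono (ZMod 3) ({nxt i} : Finset (Fin n)) x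
  rw [mono_singleton_apply]; exact predW_eq_aux _ _ _

/-- ★ the predecessor witness is a strategy of `𝔽₃`-degree `≤ 2`. -/
theorem predW_mem_lowDeg (i : Fin n) : predW i ∈ lowDeg (ZMod 3) n 2 := by
  have hprod : ecntFn i * ocntFn i ∈ lowDeg (ZMod 3) n (1 + 1) := mul_mem_lowDeg_add (ecntFn_mem i) (ocntFn_mem i)
  norm_num at hprod
  have h1 : ecntFn i ∈ lowDeg (ZMod 3) n 2 := lowDeg_mono (show 1 ≤ 2 by norm_num) (ecntFn_mem i)
  have h3 : mono (ZMod 3) ({nxt i} : Finset (Fin n)) ∈ lowDeg (ZMod 3) n 2 := mono_mem_lowDeg (by simp)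
  rw [predW_eq]
  exact Submodule.add_mem _ (Submodule.add_mem _ h1 (Submodule.smul_mem _ _ hprod)) (Submodule.smul_mem _ _ h3)

/-! ## §10 The same-parity law (PROVED): kernel vector = the other parity class, sign bit 0, witness silent there -/

/-- ★ KERNEL LAW (single parity class).  If all ones of `x` have parity `p` (even ring), the indicator of the OTHER parity class
is a kernel vector of `x`: its two neighbours of any position agree, and it vanishes on the ones. -/
theorem inKernel_parClass (hn : Even n) {x : Fin n → Bool} {p : ℕ} (hx : ∀ j, x j = true → par j = p) :
    InKernel x (parClass ((p + 1) % 2)) := by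
  intro b
  have h1 : parClass ((p + 1) % 2) (prv b) = parClass ((p + 1) % 2) (nxt b) := by
    simp only [parClass_apply, par_prv_eq_par_nxt hn]
  have h2 : (x b && parClass ((p + 1) % 2) b) = false := by
    cases hb : x b
    · rfl
    · have := hx b hb
      simp only [parClass_apply, Bool.true_and, decide_eq_false_iff_not]
      omega
  rw [h1, h2, Bool.xor_self, Bool.xor_false]

/-- the other parity class is a nonzero vector (`n ≥ 1`). -/
theorem parClass_ne_zero (hn : Even n) (a : Fin n) (p : ℕ) (hp : par a = p) :
    parClass (n := n) ((p + 1) % 2) ≠ fun _ => false := by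
  intro h
  have h1 := congrFun h (nxt a)
  rw [parClass_apply, par_nxt hn, hp] at h1
  simp at h1

/-- on a single-parity input the canonical kernel vector IS the other parity class (`n ≥ 3`, odd class). -/
theorem kvec_eq_parClass (hn : Even n) (h3 : 3 ≤ n) {x : Fin n → Bool} (hx : OddZeros x) {a : Fin n} (ha : x a = true)
    {p : ℕ} (hp : ∀ j, x j = true → par j = p) : kvec x = parClass ((p + 1) % 2) := by
  rcases (kernel_pair_of_oddZeros h3 hx _).mp (inKernel_parClass hn hp) with h | h
  · exact absurd h (parClass_ne_zero hn a p (hp a ha))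
  · exact h.symm

/-- the other parity class contains no ring edge: its sign bit has no edge term … -/
theorem edgesIn_parClass (hn : Even n) (q : ℕ) : edgesIn (parClass (n := n) q) = 0 := by
  unfold edgesIn
  rw [Finset.card_eq_zero, Finset.filter_eq_empty_iff]
  intro b _ h
  simp only [parClass_apply, decide_eq_true_eq] at h
  have := par_nxt_ne hn b
  omega

/-- … and meets none of the ones. -/
theorem wtAnd_parClass {x : Fin n → Bool} {p : ℕ} (hx : ∀ j, x j = true → par j = p) :
    wtAnd x (parClass ((p + 1) % 2)) = 0 := by
  unfold wtAnd
  rw [Finset.card_eq_zero, Finset.filter_eq_empty_iff]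
  intro b _ h
  simp only [parClass_apply, decide_eq_true_eq] at h
  have := hx b h.1
  omega

/-- hence its sign bit vanishes. -/
theorem signBit_parClass (hn : Even n) {x : Fin n → Bool} {p : ℕ} (hx : ∀ j, x j = true → par j = p) :
    signBit x (parClass ((p + 1) % 2)) = 0 := by
  unfold signBit; rw [edgesIn_parClass hn, wtAnd_parClass hx]

/-- off the marked parity class the class count vanishes … -/
theorem ecnt_eq_zero_of_par_ne {x : Fin n → Bool} {p : ℕ} (hx : ∀ j, x j = true → par j = p) {b : Fin n} (hb : par b ≠ p) :
    ecnt b x = 0 := by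
  unfold ecnt
  rw [Finset.card_eq_zero, Finset.filter_eq_empty_iff]
  intro j _ h
  exact hb (h.2 ▸ (hx j h.1))

/-- … so the witness answers `2·x_{b+1} ∈ {0,2}`, never `1`, there. -/
theorem predW_ne_one_of_par_ne {x : Fin n → Bool} {p : ℕ} (hx : ∀ j, x j = true → par j = p) {b : Fin n} (hb : par b ≠ p) :
    predW b x ≠ 1 := by
  unfold predW
  rw [ecnt_eq_zero_of_par_ne hx hb]
  by_cases h : x (nxt b) = true
  · rw [if_pos h]; norm_num; decide
  · rw [if_neg h]; norm_num

/-- the witness's answer string is disjoint from the other parity class. -/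
theorem dot2_parClass_predAns {x : Fin n → Bool} {p : ℕ} (hx : ∀ j, x j = true → par j = p) :
    dot2 (parClass ((p + 1) % 2)) (predAns x) = 0 := by
  unfold dot2
  rw [Finset.card_eq_zero.mpr, Nat.zero_mod]
  rw [Finset.filter_eq_empty_iff]
  intro b _ h
  simp only [parClass_apply, predAns, decide_eq_true_eq] at h
  exact predW_ne_one_of_par_ne hx (by omega) h.2

/-- an odd-class input of an even ring has a one. -/
theorem exists_true_of_oddZeros (hn : Even n) {x : Fin n → Bool} (hx : OddZeros x) : ∃ a, x a = true := by
  by_contra h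
  simp only [not_exists, Bool.not_eq_true] at h
  have hall : (univ.filter fun b : Fin n => x b = false) = univ := by
    rw [Finset.filter_eq_self]; intro b _; exact h b
  unfold OddZeros at hx
  rw [hall, Finset.card_univ, Fintype.card_fin] at hx
  obtain ⟨m, hm⟩ := hn; omega

/-- ★ SAME-PARITY LAW (PROVED rung of the predecessor law).  On an even ring (`n ≥ 3`), the predecessor witness answers the
ring relation correctly on EVERY odd-class input whose ones lie in one parity class — every weight; in particular on all light
inputs of weight 1 and of parity split `(3,0)`, `(5,0)`. -/
theorem rel_predW_of_sameParity (hn : Even n) (h3 : 3 ≤ n) {x : Fin n → Bool} (hx : OddZeros x)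
    (hsame : ∀ j k, x j = true → x k = true → par j = par k) : Rel x (predAns x) := by
  obtain ⟨a, ha⟩ := exists_true_of_oddZeros hn hx
  have hp : ∀ j, x j = true → par j = par a := fun j hj => hsame j a hj ha
  have hK := kernel_pair_of_oddZeros h3 hx
  rw [rel_iff_of_kernel_pair x (kvec x) _ hK, kvec_eq_parClass hn h3 hx ha hp,
    signBit_parClass hn hp, dot2_parClass_predAns hp]

/-- the weight-one instance (every one-point input is single-parity). -/
theorem rel_predW_of_wt_one (hn : Even n) (h3 : 3 ≤ n) {x : Fin n → Bool} (hx : OddZeros x) (h1 : wt x = 1) :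
    Rel x (predAns x) := by
  refine rel_predW_of_sameParity hn h3 hx fun j k hj hk => ?_
  obtain ⟨a, ha⟩ := Finset.card_eq_one.mp h1
  have hj' : j ∈ univ.filter (fun i : Fin n => x i = true) := by simp [hj]
  have hk' : k ∈ univ.filter (fun i : Fin n => x i = true) := by simp [hk]
  rw [wt] at h1
  rw [ha, Finset.mem_singleton] at hj' hk'
  rw [hj', hk']

/-! ## §11 The typed residual and the assembled negative lemma -/

/-- `PredWPerfect n w`: the predecessor witness is perfect on the light odd-class inputs of weight `≤ w` at length `n`
(numerically TRUE for `w = 5` at every even `10 ≤ n ≤ 30`, FALSE for `w = 7`; g26 `num/Q-STRUCTURE.md`, critic 69v66). -/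
def PredWPerfect (n w : ℕ) : Prop :=
  ∀ x : Fin n → Bool, OddZeros x → wt x ≤ w → Rel x (predAns x)

/-- a perfect-on-light degree-2 witness takes the length OUT of the light-losing slice. -/
theorem not_mem_lightLosing_of_predWPerfect {w : ℕ} (h : PredWPerfect n w) : n ∉ lightLosing 2 w := by
  intro hl
  obtain ⟨x, hx, hw, hr⟩ := (mem_lightLosing 2 w n).mp hl predW predW_mem_lowDeg
  exact hr (h x hx hw)

/-- ★ the dial consequence: if the witness is perfect to weight `w` at every large EVEN length, `LightFail 2 w` is false
(`LightFail` asks for ALL large lengths). -/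
theorem not_lightFail_of_predWPerfect {w n₁ : ℕ} (h : ∀ n, Even n → n₁ ≤ n → PredWPerfect n w) : ¬ LightFail 2 w := by
  rintro ⟨n₀, hn₀⟩
  have he : Even (2 * (n₀ + n₁)) := even_two_mul _
  exact not_mem_lightLosing_of_predWPerfect (h _ he (by omega)) (hn₀ _ (by omega))

end Summit.QuantumAdvantage.QuantumAdvantage.Theorems.LightDial
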